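import Summits.QuantumFields.YangMills.Theorems.SwapVirialDeficitBlowUpGnomonicRingChart
import Summits.QuantumFields.YangMills.Theorems.SwapVirialDeficitGnomonicSpeedLeaders
import Summits.QuantumFields.YangMills.Theorems.SwapTwistDeficitPeriodicRingFloorLog
import HarnessLib

/-!
# The followers' Euler weight is controlled by the deficit: `W_F ≤ 4608·L⁶·|Fol L|·F̂` pointwise (principal sector)

After (V3′) (fcl-p3 g46's ✓`virial_decomposition`: `b⟨F̂⟩ = α − ½⟨W⟩ + b⟨R⟩` per gnomonic fibre) the window row of ⟨24197⟩ is
`½⟨W⟩_b − b⟨R⟩_b ≤ 1/2 − c` uniformly on `L ≤ b^a`.  The Euler weight splits as `W = W_L + W_F` (three leader letters ∕ `|Fol L| = 6L⁴ − 3` followers).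
This file shows that THE FOLLOWERS' HALF `W_F` IS DOMINATED BY THE DEFICIT ITSELF, pointwise and with a polynomial constant:

* §1 (one letter `U = quatToSU2 (gnoLetter ε v)`, `q = su2Quat U`): `re_su2Quat_gnoLetter` (`Re q = ±(1+|v|²)^{-1/2}`), `re_sq_su2Quat_gnoLetter`,
  ★ `gnomonicW_eq_four_mul` (`W(v) = 4(1 − (Re q)²)` — a class function of the letter), `four_mul_one_sub_re_sq_le` (`≤ 4‖q − 1‖²` on the unit sphere),
  ★ `gnomonicW_le_two_mul_frobNorm_sq` (`W(v) ≤ 2‖U − 1‖_F²`, ✓`frobNorm_sub_eq_sqrt_two_mul_norm_su2Quat_sub`);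
* §2 ★★★ `sum_gnomonicW_followers_le_chartDeficit` — principal sector (`z ≡ 0`, `χ ≡ 1`), every hub `a`, signs `ε`, coordinates `η`:
  `Σ_f W(η_f) ≤ 4608·L⁶·|Fol L|·chartDeficit L 0 1 (blowUpPoint 1 (gnomonicPoint a ε η))` (✓`chartBox_of_chartDeficit`: every follower is within `48L³√F̂`
  of `1`), ★★ `gnoW_le_chartDeficit` (`gnoW η ≤ 12 + 4608·L⁶·|Fol L|·F̂`), ★ `sum_gnomonicW_followers_le_pow_ten` (`≤ 27648·L^{10}·F̂`).
  Hence `½⟨W_F⟩_b ≤ 13824·L^{10}·⟨F̂⟩_b`, and `b⟨F̂⟩_b` is `O(poly(L)·log b)` by the thermodynamic sandwich — the followers' virial correction is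
  harmless on any window `L ≤ b^a`; what remains of `½⟨W⟩` is the three leader letters (`W_L ≤ 12` trivially; its smallness is the hub-scale question).

HONEST LABEL: a deterministic pointwise inequality at fixed `L` (bookkeeping for the window programme of a DRAFT line); no estimate on ⟨24197⟩
(window-uniform, OPEN) is claimed — the leaders' weight `W_L` and the remainder `b⟨R⟩_b` are untouched; ⟨24194⟩ ∕ ⟨24497⟩ OPEN; own crux ⟨22884⟩ OPEN
(blocked-on ⟨19935⟩); no crux, rung of record or summit is proved; the Yang–Mills mass gap is NOT proved; no summit is proved by a line.  THEOREMS ONLY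
(0 `def`, 0 `sorry`), standard axioms.  Width seat ym-line-sfw-p2-w2 g57 (cell ym-idea-1, free hands), `--supports stmt-QuantumFields-24197`.
References: [cite: Luscher1983, §2]; [cite: tHooft1979]; [cite: MontvayMunster1994, §3.2.3 (3.97)]; [folklore].
-/

set_option autoImplicit false
set_option synthInstance.maxSize 1024

noncomputable section

open MeasureTheory Quaternion Set
open scoped Quaternion ENNReal BigOperators RealInnerProductSpace
open Literature.MathematicalPhysics.QuantumLattice
open Literature.MathematicalPhysics.QuantumFieldTheory hiding SU2
open Summit.QuantumFields.YangMills.Theorems.SwapTwistDeficit.ToronLog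

namespace Summit.QuantumFields.YangMills.Theorems.SwapVirialDeficit.BlowUpRing

open Literature.Analysis.Calculus (radialUnit radialUnit_def)
open Summit.QuantumFields.YangMills.Theorems.FemtoTransferGap
open Summit.QuantumFields.YangMills.Theorems.FemtoTransferGap.TT
open Summit.QuantumFields.YangMills.Theorems.VirialFluxGap.RingDeficit
open Summit.QuantumFields.YangMills.Theorems.SwapVirialDeficit.SwapRing
open Summit.QuantumFields.YangMills.Theorems.SwapVirialDeficit.ZeroModeSigma (dilateIm)
open Summit.QuantumFields.YangMills.Theorems.SwapVirialDeficit.BlowUp (dilateIm_one_apply)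
open Summit.QuantumFields.YangMills.Theorems.SwapVirialDeficit.Gnomonic (gnomonicW normSq3 normSq3_nonneg gnomonicW_nonneg_le
  su2Quat_quatToSU2_smul_gnomonicQuat inner_one_right abs_gnoSign)
open Summit.QuantumFields.YangMills.Theorems.SwapTwistDeficit.PeriodicRingFloor (frobNorm_sub_eq_sqrt_two_mul_norm_su2Quat_sub)

variable {L : ℕ} [NeZero L]

/-! ## §1 One letter: `W(v) = 4(1 − (Re q)²) ≤ 4‖q − 1‖² = 2‖U − 1‖_F²` -/

omit [NeZero L] in
/-- The real part of the normalised gnomonic letter: `Re q(±(1,v)) = ±(1+|v|²)^{-1/2}`. [folklore] -/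
theorem re_su2Quat_gnoLetter (ε : Bool) (v : Fin 3 → ℝ) :
    (su2Quat (quatToSU2 (gnoLetter ε v))).re = gnoSign ε * ‖gnomonicQuat v‖⁻¹ := by
  rw [gnoLetter_eq, su2Quat_quatToSU2_smul_gnomonicQuat (abs_gnoSign ε), radialUnit_def, smul_smul, Quaternion.re_smul, smul_eq_mul,
    show (gnomonicQuat v).re = 1 from rfl, mul_one]

omit [NeZero L] in
/-- `(Re q)² = (1 + |v|²)⁻¹`. [folklore] -/
theorem re_sq_su2Quat_gnoLetter (ε : Bool) (v : Fin 3 → ℝ) :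
    (su2Quat (quatToSU2 (gnoLetter ε v))).re ^ 2 = (1 + normSq3 v)⁻¹ := by
  rw [re_su2Quat_gnoLetter, mul_pow, gnoSign_sq, one_mul, inv_pow, sq_norm_gnomonicQuat]
  rfl

omit [NeZero L] in
/-- ★ THE EULER WEIGHT IS A CLASS FUNCTION OF THE LETTER: `W(v) = 4(1 − (Re q)²) = 4 sin²(angle of U)`. [folklore] -/
theorem gnomonicW_eq_four_mul (ε : Bool) (v : Fin 3 → ℝ) :
    gnomonicW v = 4 * (1 - (su2Quat (quatToSU2 (gnoLetter ε v))).re ^ 2) := by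
  rw [re_sq_su2Quat_gnoLetter]
  unfold gnomonicW
  have h := normSq3_nonneg v
  field_simp
  ring

/-- For a unit quaternion, `4(1 − (Re q)²) ≤ 4‖q − 1‖²` (`‖q − 1‖² = 2 − 2 Re q`, `1 + Re q ≤ 2`). [folklore] -/
theorem four_mul_one_sub_re_sq_le {q : ℍ} (hq : ‖q‖ = 1) : 4 * (1 - q.re ^ 2) ≤ 4 * ‖q - 1‖ ^ 2 := by
  have h1 : ‖q - 1‖ ^ 2 = 2 - 2 * q.re := by
    rw [@norm_sub_sq_real ℍ, inner_one_right, hq, norm_one]; ring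
  have h2 := abs_le.1 ((abs_re_le_norm q).trans_eq hq)
  nlinarith [h2.1, h2.2]

omit [NeZero L] in
/-- ★ `W(v) ≤ 2‖U − 1‖_F²` for the letter `U = quatToSU2 (gnoLetter ε v)` (✓`frobNorm_sub_eq_sqrt_two_mul_norm_su2Quat_sub`). [folklore] -/
theorem gnomonicW_le_two_mul_frobNorm_sq (ε : Bool) (v : Fin 3 → ℝ) :
    gnomonicW v ≤ 2 * frobNorm (((quatToSU2 (gnoLetter ε v) : SU2) : Matrix (Fin 2) (Fin 2) ℂ) - 1) ^ 2 := by
  have hF : frobNorm (((quatToSU2 (gnoLetter ε v) : SU2) : Matrix (Fin 2) (Fin 2) ℂ) - 1) =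
      Real.sqrt 2 * ‖su2Quat (quatToSU2 (gnoLetter ε v)) - 1‖ := by
    have h := frobNorm_sub_eq_sqrt_two_mul_norm_su2Quat_sub (quatToSU2 (gnoLetter ε v)) 1
    rw [su2Quat_one] at h
    simpa using h
  rw [gnomonicW_eq_four_mul ε v, hF, mul_pow, Real.sq_sqrt (by norm_num : (0:ℝ) ≤ 2)]
  have h := four_mul_one_sub_re_sq_le (norm_su2Quat (quatToSU2 (gnoLetter ε v)))
  linarith

/-! ## §2 The followers' Euler weight against the deficit (principal sector) -/

/-- ★★★ **THE FOLLOWERS' EULER WEIGHT IS `O(L^{10})·F̂` POINTWISE** (principal sector `z ≡ 0`, `χ ≡ 1`): at every point of the joint gnomonic chart,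
`Σ_f W(η_f) ≤ 4608·L⁶·|Fol L|·F̂(a,ε,η)` (✓`chartBox_of_chartDeficit`: every follower is within `48L³√F̂` of `1` in Frobenius norm; §1). Consequently
`⟨W_F⟩_b ≤ 4608·L⁶·|Fol L|·⟨F̂⟩_b` for the virial Gibbs weights — the followers' half of the virial correction `½⟨W⟩` is as small as the mean deficit.
[cite: Luscher1983, §2] [cite: tHooft1979] -/
theorem sum_gnomonicW_followers_le_chartDeficit (a : ℍ) (ε : GnoSign L) (η : GnoCoord L) :
    ∑ f, gnomonicW (η.2.2 f) ≤
      4608 * (L : ℝ) ^ 6 * (Fintype.card (Fol L) : ℝ) * chartDeficit L (fun _ => false) (fun _ => 1) (blowUpPoint 1 (gnomonicPoint a ε η)) := by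
  obtain ⟨-, -, hfol⟩ := chartBox_of_chartDeficit (blowUpPoint (L := L) 1 (gnomonicPoint a ε η))
  have hF0 := chartDeficit_nonneg (fun _ => false) (fun _ => (1 : SU2)) (blowUpPoint (L := L) 1 (gnomonicPoint a ε η))
  have hf : ∀ f : Fol L, gnomonicW (η.2.2 f) ≤ 4608 * (L : ℝ) ^ 6 * chartDeficit L (fun _ => false) (fun _ => 1) (blowUpPoint 1 (gnomonicPoint a ε η)) :=
    fun f => by
      have h := hfol f
      have e : (blowUpPoint (L := L) 1 (gnomonicPoint a ε η)).2 f = quatToSU2 (gnoLetter (ε.2.2 f) (η.2.2 f)) := by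
        simp only [blowUpPoint, gnomonicPoint, dilateIm_one_apply]
      rw [e] at h
      have h0 := frobNorm_nonneg (((quatToSU2 (gnoLetter (ε.2.2 f) (η.2.2 f)) : SU2) : Matrix (Fin 2) (Fin 2) ℂ) - 1)
      calc gnomonicW (η.2.2 f) ≤ 2 * frobNorm (((quatToSU2 (gnoLetter (ε.2.2 f) (η.2.2 f)) : SU2) : Matrix (Fin 2) (Fin 2) ℂ) - 1) ^ 2 :=
            gnomonicW_le_two_mul_frobNorm_sq _ _
        _ ≤ 2 * (48 * (L : ℝ) ^ 3 * Real.sqrt (chartDeficit L (fun _ => false) (fun _ => 1) (blowUpPoint 1 (gnomonicPoint a ε η)))) ^ 2 := by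
            gcongr
        _ = 4608 * (L : ℝ) ^ 6 * chartDeficit L (fun _ => false) (fun _ => 1) (blowUpPoint 1 (gnomonicPoint a ε η)) := by
            rw [mul_pow, mul_pow, Real.sq_sqrt hF0]; ring
  calc ∑ f, gnomonicW (η.2.2 f) ≤ ∑ _f : Fol L, 4608 * (L : ℝ) ^ 6 * chartDeficit L (fun _ => false) (fun _ => 1) (blowUpPoint 1 (gnomonicPoint a ε η)) :=
        Finset.sum_le_sum fun f _ => hf f
    _ = _ := by rw [Finset.sum_const, Finset.card_univ, nsmul_eq_mul]; ring

/-- ★★ The full Euler weight: `gnoW η ≤ 12 + 4608·L⁶·|Fol L|·F̂` (the three leader letters contribute at most `4` each). [cite: Luscher1983, §2] -/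
theorem gnoW_le_chartDeficit (a : ℍ) (ε : GnoSign L) (η : GnoCoord L) :
    gnoW η ≤ 12 + 4608 * (L : ℝ) ^ 6 * (Fintype.card (Fol L) : ℝ) * chartDeficit L (fun _ => false) (fun _ => 1) (blowUpPoint 1 (gnomonicPoint a ε η)) := by
  have h1 := (gnoWtr_nonneg_le η.1.1).2
  have h2 := (gnoWtr_nonneg_le η.1.2).2
  have h3 := (gnomonicW_nonneg_le η.2.1).2
  have h4 := sum_gnomonicW_followers_le_chartDeficit a ε η
  unfold gnoW
  linarith

/-- ★ With `|Fol L| = 6L⁴ − 3 ≤ 6L⁴`: `Σ_f W(η_f) ≤ 27648·L^{10}·F̂`. [cite: Luscher1983, §2] -/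
theorem sum_gnomonicW_followers_le_pow_ten (a : ℍ) (ε : GnoSign L) (η : GnoCoord L) :
    ∑ f, gnomonicW (η.2.2 f) ≤ 27648 * (L : ℝ) ^ 10 * chartDeficit L (fun _ => false) (fun _ => 1) (blowUpPoint 1 (gnomonicPoint a ε η)) := by
  have h := sum_gnomonicW_followers_le_chartDeficit a ε η
  have hF0 := chartDeficit_nonneg (fun _ => false) (fun _ => (1 : SU2)) (blowUpPoint (L := L) 1 (gnomonicPoint a ε η))
  have hc : (Fintype.card (Fol L) : ℝ) ≤ 6 * (L : ℝ) ^ 4 := by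
    rw [card_fol]
    have h6 : 3 ≤ 6 * L ^ 4 := by
      have := Nat.one_le_iff_ne_zero.mpr (NeZero.ne L)
      nlinarith [Nat.one_le_pow 4 L this]
    push_cast [Nat.cast_sub h6]
    linarith
  calc ∑ f, gnomonicW (η.2.2 f) ≤ 4608 * (L : ℝ) ^ 6 * (Fintype.card (Fol L) : ℝ) * chartDeficit L (fun _ => false) (fun _ => 1) (blowUpPoint 1 (gnomonicPoint a ε η)) := h
    _ ≤ 4608 * (L : ℝ) ^ 6 * (6 * (L : ℝ) ^ 4) * chartDeficit L (fun _ => false) (fun _ => 1) (blowUpPoint 1 (gnomonicPoint a ε η)) := by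
        gcongr
    _ = _ := by ring

end Summit.QuantumFields.YangMills.Theorems.SwapVirialDeficit.BlowUpRing

end
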